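import Literature.Combinatorics.SimpleGraph.KYCrossVector
import Literature.Combinatorics.SimpleGraph.KYSeidelToolkit
import HarnessLib

/-!
# Kunisky–Yu §3.6: bounds for the cross vector `w = H^{1,2}v`

Continuation of `KYCrossVector.lean` (Kunisky–Yu 2022, arXiv:2211.02713, (55) and (64)–(65)): the
two
quantities entering the second Schur complement (`KYSchurReduction.lean`),
`Σ_a (w_a − t)²` with `t = (α₃/4 − α₁α₂)σ₀` and `(Σ_a w_a)²`, are bounded through the elementary
toolkit (`KYSeidelToolkit.lean`) for a conference Seidel matrix (`S𝟙 = 0`, `S² = qI − J`):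

* `sum_sq_crossVector_sub_le` —
  `Σ_a (w_a − t)² ≤ 2(2α₂ − α₃/2)² G₂ + (3/2)α₃² q G₂ + (3/8)α₃² q² N₂ + (3/2)α₃² q N₂`;
* `sq_sum_crossVector_le` —
  `(Σ_a w_a)² ≤ 2(2α₂ − ¾α₃ + (α₃/4 − α₁α₂)q)² σ₀² + (α₃²/2) q² N₂`,

with `G₂ = Σ_a (Σ_b Vm_{ab})²`, `N₂ = Σ Vm²`, `σ₀ = Σ Vm` (only `(x+y)² ≤ 2x² + 2y²` and
Cauchy–Schwarz).

## References

* [KuniskyYu2022] D. Kunisky, X. Yu, arXiv:2211.02713, (55), (64)–(65).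
-/

noncomputable section

namespace Literature.Combinatorics.SimpleGraph

open Matrix Finset

section CrossBounds

variable {V : Type*} [Fintype V] [DecidableEq V] (G : _root_.SimpleGraph V) [DecidableRel G.Adj]

omit [Fintype V] in
/-- The Seidel matrix of `hS` is symmetric. [cite: KuniskyYu2022, §2.1] -/
theorem seidel_symm_of_hS {S : Matrix V V ℝ}
    (hS : ∀ a b, S a b = if a = b then 0 else if G.Adj a b then 1 else -1) (x y : V) :
    S x y = S y x := by
  rw [hS, hS]
  by_cases h : x = y
  · subst h; rfl
  · rw [if_neg h, if_neg (Ne.symm h)]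
    by_cases hadj : G.Adj x y
    · rw [if_pos hadj, if_pos hadj.symm]
    · rw [if_neg hadj, if_neg (fun h' => hadj h'.symm)]

omit [Fintype V] in
/-- The Seidel matrix of `hS` has entries in `[-1, 1]`. [cite: KuniskyYu2022, §2.1] -/
theorem seidel_abs_le_one_of_hS {S : Matrix V V ℝ}
    (hS : ∀ a b, S a b = if a = b then 0 else if G.Adj a b then 1 else -1) (x y : V) :
    |S x y| ≤ 1 := by
  rw [hS]; split_ifs <;> simp

/-- Three-term square bound: `(x + y + z)² ≤ 3(x² + y² + z²)`. [folklore] -/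
theorem sq_add_add_le_three (x y z : ℝ) : (x + y + z) ^ 2 ≤ 3 * (x ^ 2 + y ^ 2 + z ^ 2) := by
  nlinarith [sq_nonneg (x - y), sq_nonneg (y - z), sq_nonneg (x - z)]

/-- **Bound for `Σ_a (w_a − t)²`** (`t = (α₃/4 − α₁α₂)σ₀`; the `(I − P₀)`-part of `H^{2,1}H^{1,2}`
in
KY (46)–(47), (65)):
`Σ_a (w_a − t)² ≤ 2(2α₂ − α₃/2)² G₂ + (3/2)α₃² q G₂ + (3/8)α₃² q² N₂ + (3/2)α₃² q N₂`.
[cite: KuniskyYu2022, (65)] -/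
theorem sum_sq_crossVector_sub_le {S : Matrix V V ℝ}
    (hS : ∀ a b, S a b = if a = b then 0 else if G.Adj a b then 1 else -1)
    (hsq : S * S = (Fintype.card V : ℝ) • (1 : Matrix V V ℝ) - of fun _ _ => 1)
    (α : ℕ → ℝ) (Vm : Matrix V V ℝ) (hVs : ∀ x y, Vm x y = Vm y x) (hVd : ∀ x, Vm x x = 0) :
    ∑ a, ((∑ c, ∑ d, Vm c d * kyEntry G α {a} {c, d}) -
        (α 3 / 4 - α 1 * α 2) * ∑ c, ∑ d, Vm c d) ^ 2 ≤
      2 * (2 * α 2 - α 3 / 2) ^ 2 * ∑ a, (∑ b, Vm a b) ^ 2 +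
        3 / 2 * α 3 ^ 2 * Fintype.card V * ∑ a, (∑ b, Vm a b) ^ 2 +
        3 / 8 * α 3 ^ 2 * (Fintype.card V : ℝ) ^ 2 * ∑ a, ∑ b, Vm a b ^ 2 +
        3 / 2 * α 3 ^ 2 * Fintype.card V * ∑ a, ∑ b, Vm a b ^ 2 := by
  have hSs := seidel_symm_of_hS G hS
  have hSb := seidel_abs_le_one_of_hS G hS
  set q : ℝ := (Fintype.card V : ℝ) with hq
  -- the three small vectors
  set Sg : V → ℝ := fun a => ∑ c, S a c * ∑ d, Vm c d with hSg
  set ell : V → ℝ := fun a => ∑ c, ∑ d, S a c * Vm c d * S d a with hell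
  set hv : V → ℝ := fun a => ∑ c, S a c * Vm c a with hhv
  set g : V → ℝ := fun a => ∑ b, Vm a b with hg
  -- pointwise decomposition of `w_a - t`
  have hw : ∀ a, (∑ c, ∑ d, Vm c d * kyEntry G α {a} {c, d}) -
      (α 3 / 4 - α 1 * α 2) * ∑ c, ∑ d, Vm c d =
      (2 * α 2 - α 3 / 2) * g a + (α 3 / 2 * Sg a + α 3 / 4 * ell a + (-(α 3 / 2)) * hv a) := by
    intro a
    rw [crossVector_eq G hS α Vm hVs hVd a]
    simp only [hSg, hell, hhv, hg]
    ring
  have hpt : ∀ a, ((∑ c, ∑ d, Vm c d * kyEntry G α {a} {c, d}) -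
      (α 3 / 4 - α 1 * α 2) * ∑ c, ∑ d, Vm c d) ^ 2 ≤
      2 * (2 * α 2 - α 3 / 2) ^ 2 * g a ^ 2 +
        6 * ((α 3 / 2) ^ 2 * Sg a ^ 2 + (α 3 / 4) ^ 2 * ell a ^ 2 + (α 3 / 2) ^ 2 * hv a ^ 2) := by
    intro a
    rw [hw a]
    have h1 := sq_add_add_le_three (α 3 / 2 * Sg a) (α 3 / 4 * ell a) (-(α 3 / 2) * hv a)
    nlinarith [sq_nonneg ((2 * α 2 - α 3 / 2) * g a -
      (α 3 / 2 * Sg a + α 3 / 4 * ell a + (-(α 3 / 2)) * hv a))]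
  -- sum and use the toolkit
  have hSg2 : ∑ a, Sg a ^ 2 ≤ q * ∑ a, g a ^ 2 := by
    have h := sum_sq_seidel_apply hSs hsq g
    simp only [hSg, hg] at h ⊢
    rw [h]
    nlinarith [sq_nonneg (∑ a, ∑ b, Vm a b)]
  have hell2 : ∑ a, ell a ^ 2 ≤ q ^ 2 * ∑ a, ∑ b, Vm a b ^ 2 := sum_sq_diag_SVS_le hSs hsq Vm hVs
  have hhv2 : ∑ a, hv a ^ 2 ≤ q * ∑ a, ∑ b, Vm a b ^ 2 := sum_sq_SV_diag_le hSb Vm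
  have hα3 : 0 ≤ α 3 ^ 2 := sq_nonneg _
  calc ∑ a, ((∑ c, ∑ d, Vm c d * kyEntry G α {a} {c, d}) -
        (α 3 / 4 - α 1 * α 2) * ∑ c, ∑ d, Vm c d) ^ 2
      ≤ ∑ a, (2 * (2 * α 2 - α 3 / 2) ^ 2 * g a ^ 2 +
        6 * ((α 3 / 2) ^ 2 * Sg a ^ 2 + (α 3 / 4) ^ 2 * ell a ^ 2 + (α 3 / 2) ^ 2 * hv a ^ 2)) :=
        Finset.sum_le_sum fun a _ => hpt a
    _ = 2 * (2 * α 2 - α 3 / 2) ^ 2 * ∑ a, g a ^ 2 + 3 / 2 * α 3 ^ 2 * ∑ a, Sg a ^ 2 +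
        3 / 8 * α 3 ^ 2 * ∑ a, ell a ^ 2 + 3 / 2 * α 3 ^ 2 * ∑ a, hv a ^ 2 := by
        simp only [Finset.sum_add_distrib, ← Finset.mul_sum]
        ring
    _ ≤ 2 * (2 * α 2 - α 3 / 2) ^ 2 * ∑ a, g a ^ 2 + 3 / 2 * α 3 ^ 2 * (q * ∑ a, g a ^ 2) +
        3 / 8 * α 3 ^ 2 * (q ^ 2 * ∑ a, ∑ b, Vm a b ^ 2) +
        3 / 2 * α 3 ^ 2 * (q * ∑ a, ∑ b, Vm a b ^ 2) := by
        have h1 := mul_le_mul_of_nonneg_left hSg2 (by positivity : 0 ≤ 3 / 2 * α 3 ^ 2)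
        have h2 := mul_le_mul_of_nonneg_left hell2 (by positivity : 0 ≤ 3 / 8 * α 3 ^ 2)
        have h3 := mul_le_mul_of_nonneg_left hhv2 (by positivity : 0 ≤ 3 / 2 * α 3 ^ 2)
        linarith
    _ = _ := by simp only [hg]; ring

/-- **Bound for `(Σ_a w_a)²`** (the `P₀`-part of `H^{2,1}H^{1,2}`, KY (46) and (64)):
`(Σ_a w_a)² ≤ 2(2α₂ − ¾α₃ + (α₃/4 − α₁α₂)q)² σ₀² + (α₃²/2) q² N₂`. [cite: KuniskyYu2022, (64)] -/
theorem sq_sum_crossVector_le {S : Matrix V V ℝ}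
    (hS : ∀ a b, S a b = if a = b then 0 else if G.Adj a b then 1 else -1)
    (hrow : ∀ a, ∑ b, S a b = 0)
    (hsq : S * S = (Fintype.card V : ℝ) • (1 : Matrix V V ℝ) - of fun _ _ => 1)
    (α : ℕ → ℝ) (Vm : Matrix V V ℝ) (hVs : ∀ x y, Vm x y = Vm y x) (hVd : ∀ x, Vm x x = 0) :
    (∑ a, ∑ c, ∑ d, Vm c d * kyEntry G α {a} {c, d}) ^ 2 ≤
      2 * (2 * α 2 - 3 / 4 * α 3 + (α 3 / 4 - α 1 * α 2) * Fintype.card V) ^ 2 *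
          (∑ c, ∑ d, Vm c d) ^ 2 +
        α 3 ^ 2 / 2 * (Fintype.card V : ℝ) ^ 2 * ∑ a, ∑ b, Vm a b ^ 2 := by
  have hSb := seidel_abs_le_one_of_hS G hS
  rw [sum_crossVector_eq G hS hrow hsq α Vm hVs hVd]
  have hτ := sq_sum_SV_le hSb Vm
  set P : ℝ := 2 * α 2 - 3 / 4 * α 3 + (α 3 / 4 - α 1 * α 2) * Fintype.card V with hP
  set τ : ℝ := ∑ a, ∑ c, S a c * Vm c a with hτdef
  set σ : ℝ := ∑ c, ∑ d, Vm c d with hσ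
  have h1 : (P * σ - α 3 / 2 * τ) ^ 2 ≤ 2 * (P * σ) ^ 2 + 2 * (α 3 / 2 * τ) ^ 2 := by
    nlinarith [sq_nonneg (P * σ + α 3 / 2 * τ)]
  have hα : 0 ≤ (α 3 / 2) ^ 2 := sq_nonneg _
  have h2 : 2 * (α 3 / 2 * τ) ^ 2 ≤ α 3 ^ 2 / 2 * ((Fintype.card V : ℝ) ^ 2 * ∑ a, ∑ b, Vm a b ^ 2) := by
    have h := mul_le_mul_of_nonneg_left hτ hα
    nlinarith
  nlinarith

end CrossBounds

end Literature.Combinatorics.SimpleGraph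

end
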